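import Summits.MatrixMultiplication.MatrixMultiplication.Theorems.ObstructionCalculusSchurWeylDegree
import Summits.MatrixMultiplication.MatrixMultiplication.Theorems.ObstructionDescentSchurWeylObligation
import Summits.MatrixMultiplication.MatrixMultiplication.Theorems.ObstructionDescentCoreWindow

set_option linter.dupNamespace false
set_option autoImplicit false

/-!
# Obstruction descent — `P_O` from SHORT KRONECKER INDECOMPOSABLES (decomp-mm · lens 3 · gen 29, def-free)

`route-MatrixMultiplication-ObstructionDescent`, crux `NoOccurrenceObstruction` (`P_O`, stmt 29040); NODE-g29 §6.

Through the Schur–Weyl bridge the crux is `S(⟨n,n,n⟩) ⊆ S(⟨m⟩)` (`m ≥ n^τ`, eventually).  Two facts about the target semigroup are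
theorems: `S(⟨m⟩)` is a SEMIGROUP under row-wise addition of triples (Literature
`isotypicSum₁₂₃_kroneckerPow_ne_zero_of_ofPartition_add`), and it contains EVERY live triple of degree `d ≤ m`
(`isotypicSum_kroneckerPow_unitTensor_ne_zero_of_degree_le`, gen 29).  Hence it contains every triple that is a row-wise sum of
live triples of degree `≤ m`, and — the usable form — the crux need only be checked on the row-wise INDECOMPOSABLE elements of
`S(⟨n,n,n⟩)` (Bürgisser–Ikenmeyer's §10.4 argument «generators of the semigroup suffice», run against `⟨m⟩`):

* §1 `isotypicSum_kroneckerPow_unitTensor_ne_zero_of_splitting` — at a fixed pair `(N, m)`: if every live triple of format `m` with at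
  most `N` parts per slot and degree `d > m` SPLITS row-wise into two live triples of positive degree, then every live triple with ≤ `N`
  parts lies in `S(⟨m⟩)` (strong induction on the degree; base = the degree engine, step = the semigroup law).  «Live» is spelled
  `∃ t ∈ ℂ^m⊗ℂ^m⊗ℂ^m, isoSum_λ(t^{⊗d}) ≠ 0`.  §2 `hwvSpace_eq_bot_of_splitting` — the same in the calculus (`UnitSaturation` at a cell).
  HONEST RANGE.  With `K_N` = Bürgisser–Ikenmeyer's Kronecker semigroup of format `(N,N,N)` (2011, §3.2; Lemma 3.2: `S(w) ⊆ K_N`, equality for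
  generic `w`, proved in §10.4 from generators of `K_N`) and `D(N)` := the largest degree of a `K_N`-indecomposable, the splitting hypothesis
  at `(N, m)` holds iff `m ≥ D(N)`, and **`D(N) ≥ N·e'(N) ≥ N^{3/2}`**: the CUBE `((δ^N), (δ^N), (δ^N))` with `δ = e'(N)` the least `δ ≥ 1`
  with `k_N(δ) = g(N×δ, N×δ, N×δ) > 0` (Bürgisser–Ikenmeyer 2017, Ex. 5.6; `e'(N) ≥ √N` since `k_N(δ) = 0` for `δ² < N`; tree
  `BI17Ex56SmallCases`: `e'(3) = e'(4) = 2`, `e'(5) = e'(6) = 3`, `e'(7) = 4`, `e'(16) = 4`) is live and row-wise indecomposable (a row-wise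
  summand of a rectangle is a rectangle, and `k_N(a) = 0` for `0 < a < e'(N)`).  Likewise the Bürgisser–Ikenmeyer obstruction
  `((2n²−3,1,1,1), 2^{n²}, 2^{n²})` is a `K_{n²}`-indecomposable of degree `2n²`.  So §1–§2 have content only for `m ≳ n³` at `N = n²`:
  the semigroup calculus ALONE does not reach the crux's formats `m ~ n^{2+ε}`, and `noOccurrenceObstruction_of_splitting` (§3, kept for
  the record) has a hypothesis that is UNSATISFIABLE for `τ < 3` — it is NOT a usable sufficient condition.
* §3 `noOccurrenceObstruction_iff_indecomposables` — **THE LOCALISATION (iff)**: `P_O` ⟺ for every `τ > 2`, eventually, every triple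
  occurring for `⟨n,n,n⟩` in degree `d > m` EITHER occurs for `⟨m⟩` OR is a row-wise sum of two triples of positive degree occurring for
  `⟨n,n,n⟩`; i.e. the obligations of the crux are exactly the row-wise indecomposable elements of `S(⟨n,n,n⟩)` of degree `> m`
  (a finite set per `n`: `S(⟨n,n,n⟩)` is finitely generated).  General form `isotypicSum_kroneckerPow_unitTensor_ne_zero_of_indecomposables`.
No proposition is defined; no `def`; sorry-free; standard axioms.  Nothing here proves `ω = 2` or closes an item.
[cite: BurgisserIkenmeyer2011, Def. 3.1, §3.2, Lemma 3.2, §10.1, §10.4, Lemma 6.1] [cite: BurgisserIkenmeyer2017, Ex. 5.6, Rem. 5.18]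
[cite: LandsbergGCT2017, Prop. 8.3.4.1]
-/

noncomputable section

open scoped BigOperators

namespace Summit.MatrixMultiplication.MatrixMultiplication.Theorems.ObstructionCalculus

open Literature.Computability.AlgebraicComplexity (kroneckerPow isotypicSum₁ isotypicSum₂ isotypicSum₃ unitTensor matMulTensor
  isotypicSum₁₂₃_kroneckerPow_ne_zero_of_ofPartition_add)
open Literature.NumberTheory.DiophantineGeometry (Weight)
open Summit.MatrixMultiplication.MatrixMultiplication.Theses.ObstructionDescent (NoOccurrenceObstruction)
open Summit.MatrixMultiplication.MatrixMultiplication.Theorems.ObstructionDescentCoreWindow (noOccurrenceObstruction_of_unitSaturation)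

variable {m : ℕ}

/-! ## §1 Every live triple is in `S(⟨m⟩)` when long live triples split (content only for `m ≥ D(N) ≥ N^{3/2}`) -/

/-- **Splitting ⟹ universality of `⟨m⟩`.**  Suppose every triple `λ ⊢ d` with `d > m`, at most `N` parts per slot and occurring for SOME
tensor of format `m` is a row-wise sum (`GL_m`-weights add) of two such triples of positive degrees.  Then every triple with at most `N`
parts per slot occurring for some tensor of format `m` occurs for `⟨m⟩`: `K_N-live ⊆ S(⟨m⟩)`.  (Strong induction on `d`: degree `≤ m` is the
degree engine; the step is the semigroup law of `S(⟨m⟩)`.) [cite: BurgisserIkenmeyer2011, Def. 3.1, §10.1] -/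
theorem isotypicSum_kroneckerPow_unitTensor_ne_zero_of_splitting {N : ℕ}
    (hsplit : ∀ d : ℕ, m < d → ∀ lam : Fin 3 → Nat.Partition d, (∀ s, (lam s).parts.card ≤ N) →
      (∃ t : Tensor ℂ m, isotypicSum₁ (lam 0) (isotypicSum₂ (lam 1) (isotypicSum₃ (lam 2) (kroneckerPow t d))) ≠ 0) →
      ∃ (d₁ d₂ : ℕ) (mu : Fin 3 → Nat.Partition d₁) (nu : Fin 3 → Nat.Partition d₂),
        0 < d₁ ∧ 0 < d₂ ∧ d₁ + d₂ = d ∧ (∀ s, (mu s).parts.card ≤ N) ∧ (∀ s, (nu s).parts.card ≤ N) ∧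
        (∃ t : Tensor ℂ m, isotypicSum₁ (mu 0) (isotypicSum₂ (mu 1) (isotypicSum₃ (mu 2) (kroneckerPow t d₁))) ≠ 0) ∧
        (∃ t : Tensor ℂ m, isotypicSum₁ (nu 0) (isotypicSum₂ (nu 1) (isotypicSum₃ (nu 2) (kroneckerPow t d₂))) ≠ 0) ∧
        ∀ s, Weight.ofPartition m (lam s) = Weight.ofPartition m (mu s) + Weight.ofPartition m (nu s))
    {d : ℕ} (lam : Fin 3 → Nat.Partition d) (hN : ∀ s, (lam s).parts.card ≤ N)
    (hlive : ∃ t : Tensor ℂ m, isotypicSum₁ (lam 0) (isotypicSum₂ (lam 1) (isotypicSum₃ (lam 2) (kroneckerPow t d))) ≠ 0) :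
    isotypicSum₁ (lam 0) (isotypicSum₂ (lam 1) (isotypicSum₃ (lam 2) (kroneckerPow (unitTensor ℂ m) d))) ≠ 0 := by
  suffices H : ∀ (d : ℕ) (lam : Fin 3 → Nat.Partition d), (∀ s, (lam s).parts.card ≤ N) →
      (∃ t : Tensor ℂ m, isotypicSum₁ (lam 0) (isotypicSum₂ (lam 1) (isotypicSum₃ (lam 2) (kroneckerPow t d))) ≠ 0) →
      isotypicSum₁ (lam 0) (isotypicSum₂ (lam 1) (isotypicSum₃ (lam 2) (kroneckerPow (unitTensor ℂ m) d))) ≠ 0 from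
    H d lam hN hlive
  intro d
  induction d using Nat.strong_induction_on with
  | _ d ih =>
    intro lam hN hlive
    by_cases hd : d ≤ m
    · obtain ⟨t, ht⟩ := hlive
      exact isotypicSum_kroneckerPow_unitTensor_ne_zero_of_degree_le hd t lam ht
    · obtain ⟨d₁, d₂, mu, nu, hd₁, hd₂, hsum, hmuN, hnuN, hmu, hnu, hw⟩ :=
        hsplit d (not_le.1 hd) lam hN hlive
      subst hsum
      exact isotypicSum₁₂₃_kroneckerPow_ne_zero_of_ofPartition_add (hw 0) (hw 1) (hw 2)
        (ih d₁ (by omega) mu hmuN hmu) (ih d₂ (by omega) nu hnuN hnu)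

/-! ## §2 The calculus form: `UnitSaturation` at a cell from splitting -/

/-- Under the reversed dictionary, the number of parts of `λˢ` is at most the support of the slot `Λ⁽ˢ⁾` (the first `#parts` reversed
coordinates carry the positive parts). [bookkeeping] -/
theorem parts_card_le_card_support {d : ℕ} (lam : Fin 3 → Nat.Partition d) (Λ : Fin 3 → Fin m → ℕ)
    (hΛ : ∀ (s : Fin 3) (i : Fin m), Λ s (Fin.rev i) = (lam s).sortedParts.getD i 0)
    (hm : ∀ s, (lam s).parts.card ≤ m) (s : Fin 3) :
    (lam s).parts.card ≤ (Finset.univ.filter fun a => Λ s a ≠ 0).card := by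
  classical
  set k := (lam s).parts.card with hk
  have hkm : k ≤ m := hm s
  let f : Fin k → Fin m := fun i => Fin.rev (Fin.castLE hkm i)
  have hinj : Function.Injective f := fun i j hij => by
    have := Fin.rev_injective hij
    exact Fin.castLE_injective hkm this
  have hsub : Finset.univ.image f ⊆ Finset.univ.filter fun a => Λ s a ≠ 0 := by
    intro a ha
    obtain ⟨i, -, rfl⟩ := Finset.mem_image.1 ha
    rw [Finset.mem_filter]
    refine ⟨Finset.mem_univ _, ?_⟩
    have hlt : (i : ℕ) < (lam s).sortedParts.length := by
      rw [Nat.Partition.length_sortedParts]; exact i.2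
    have hval : Λ s (f i) = (lam s).sortedParts.getD i 0 := hΛ s (Fin.castLE hkm i)
    rw [hval, List.getD_eq_getElem _ _ hlt]
    exact ((lam s).pos_of_mem_sortedParts (List.getElem_mem hlt)).ne'
  calc k = (Finset.univ.image f).card := by
        rw [Finset.card_image_of_injective _ hinj, Finset.card_univ, Fintype.card_fin]
    _ ≤ _ := Finset.card_le_card hsub

/-- **`UnitSaturation` at the cell `(n, m)` from splitting at `(n², m)`**: a type of format `m` with support `≤ n²` in every slot, all of
whose weight vectors vanish on `GL_m³·⟨m⟩`, has none.  (A live such type is a reversed triple of partitions with ≤ `n²` parts occurring for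
some tensor of format `m`; by §1 it occurs for `⟨m⟩`; by the bridge it is then not killed by `σ_m`.) [cite: BurgisserIkenmeyer2011, §3.1, §5] -/
theorem hwvSpace_eq_bot_of_splitting {n : ℕ}
    (hsplit : ∀ d : ℕ, m < d → ∀ lam : Fin 3 → Nat.Partition d, (∀ s, (lam s).parts.card ≤ n * n) →
      (∃ t : Tensor ℂ m, isotypicSum₁ (lam 0) (isotypicSum₂ (lam 1) (isotypicSum₃ (lam 2) (kroneckerPow t d))) ≠ 0) →
      ∃ (d₁ d₂ : ℕ) (mu : Fin 3 → Nat.Partition d₁) (nu : Fin 3 → Nat.Partition d₂),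
        0 < d₁ ∧ 0 < d₂ ∧ d₁ + d₂ = d ∧ (∀ s, (mu s).parts.card ≤ n * n) ∧ (∀ s, (nu s).parts.card ≤ n * n) ∧
        (∃ t : Tensor ℂ m, isotypicSum₁ (mu 0) (isotypicSum₂ (mu 1) (isotypicSum₃ (mu 2) (kroneckerPow t d₁))) ≠ 0) ∧
        (∃ t : Tensor ℂ m, isotypicSum₁ (nu 0) (isotypicSum₂ (nu 1) (isotypicSum₃ (nu 2) (kroneckerPow t d₂))) ≠ 0) ∧
        ∀ s, Weight.ofPartition m (lam s) = Weight.ofPartition m (mu s) + Weight.ofPartition m (nu s))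
    (Λ : Fin 3 → Fin m → ℕ) (d : ℕ) (hsupp : ∀ s, (Finset.univ.filter fun a => Λ s a ≠ 0).card ≤ n * n)
    (hU : hwvSpace Λ d ≤ orbitVanishing (unitTensor ℂ m)) : hwvSpace Λ d = ⊥ := by
  by_contra hne
  obtain ⟨lam, hm, hΛ⟩ := exists_partition_of_hwvSpace_ne_bot hne
  have hN : ∀ s, (lam s).parts.card ≤ n * n :=
    fun s => (parts_card_le_card_support lam Λ hΛ hm s).trans (hsupp s)
  have hlive := (hwvSpace_ne_bot_iff_exists_isotypicSum_ne_zero lam Λ hΛ).1 hne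
  have hocc := isotypicSum_kroneckerPow_unitTensor_ne_zero_of_splitting hsplit lam hN hlive
  exact not_hwvSpace_le_orbitVanishing_of_isotypicSum_ne_zero (unitTensor ℂ m) lam Λ hΛ hocc hU

/-! ## §3 The localisation: only row-wise indecomposable occurring triples are obligations (iff) -/

/-- **Indecomposables escape ⟹ everything escapes.**  Let `t` be any 3-tensor.  If every triple occurring for `t` in degree `d ≤ m` occurs
for `⟨m⟩`, and every triple occurring for `t` in degree `d > m` either occurs for `⟨m⟩` or is a row-wise sum (as `GL_m`-weights) of two
triples of positive degree occurring for `t`, then `S(t) ⊆ S(⟨m⟩)` (strong induction on the degree; the step is the semigroup law of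
`S(⟨m⟩)`).  This is Bürgisser–Ikenmeyer's «generators suffice» (§10.4) run against the unit tensor. [cite: BurgisserIkenmeyer2011, §3.2, §10.4] -/
theorem isotypicSum_kroneckerPow_unitTensor_ne_zero_of_indecomposables {ι κ ν : Type*} [Fintype ι] [Fintype κ] [Fintype ν]
    [DecidableEq ι] [DecidableEq κ] [DecidableEq ν] (t : ι → κ → ν → ℂ)
    (hdeg : ∀ d : ℕ, d ≤ m → ∀ lam : Fin 3 → Nat.Partition d,
      isotypicSum₁ (lam 0) (isotypicSum₂ (lam 1) (isotypicSum₃ (lam 2) (kroneckerPow t d))) ≠ 0 →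
      isotypicSum₁ (lam 0) (isotypicSum₂ (lam 1) (isotypicSum₃ (lam 2) (kroneckerPow (unitTensor ℂ m) d))) ≠ 0)
    (hind : ∀ d : ℕ, m < d → ∀ lam : Fin 3 → Nat.Partition d,
      isotypicSum₁ (lam 0) (isotypicSum₂ (lam 1) (isotypicSum₃ (lam 2) (kroneckerPow t d))) ≠ 0 →
      isotypicSum₁ (lam 0) (isotypicSum₂ (lam 1) (isotypicSum₃ (lam 2) (kroneckerPow (unitTensor ℂ m) d))) ≠ 0 ∨
      ∃ (d₁ d₂ : ℕ) (mu : Fin 3 → Nat.Partition d₁) (nu : Fin 3 → Nat.Partition d₂), 0 < d₁ ∧ 0 < d₂ ∧ d₁ + d₂ = d ∧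
        isotypicSum₁ (mu 0) (isotypicSum₂ (mu 1) (isotypicSum₃ (mu 2) (kroneckerPow t d₁))) ≠ 0 ∧
        isotypicSum₁ (nu 0) (isotypicSum₂ (nu 1) (isotypicSum₃ (nu 2) (kroneckerPow t d₂))) ≠ 0 ∧
        ∀ s, Weight.ofPartition m (lam s) = Weight.ofPartition m (mu s) + Weight.ofPartition m (nu s))
    {d : ℕ} (lam : Fin 3 → Nat.Partition d)
    (h : isotypicSum₁ (lam 0) (isotypicSum₂ (lam 1) (isotypicSum₃ (lam 2) (kroneckerPow t d))) ≠ 0) :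
    isotypicSum₁ (lam 0) (isotypicSum₂ (lam 1) (isotypicSum₃ (lam 2) (kroneckerPow (unitTensor ℂ m) d))) ≠ 0 := by
  suffices H : ∀ (d : ℕ) (lam : Fin 3 → Nat.Partition d),
      isotypicSum₁ (lam 0) (isotypicSum₂ (lam 1) (isotypicSum₃ (lam 2) (kroneckerPow t d))) ≠ 0 →
      isotypicSum₁ (lam 0) (isotypicSum₂ (lam 1) (isotypicSum₃ (lam 2) (kroneckerPow (unitTensor ℂ m) d))) ≠ 0 from
    H d lam h
  intro d
  induction d using Nat.strong_induction_on with
  | _ d ih =>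
    intro lam hlam
    by_cases hd : d ≤ m
    · exact hdeg d hd lam hlam
    · rcases hind d (not_le.1 hd) lam hlam with hunit | ⟨d₁, d₂, mu, nu, hd₁, hd₂, hsum, hmu, hnu, hw⟩
      · exact hunit
      · subst hsum
        exact isotypicSum₁₂₃_kroneckerPow_ne_zero_of_ofPartition_add (hw 0) (hw 1) (hw 2)
          (ih d₁ (by omega) mu hmu) (ih d₂ (by omega) nu hnu)

/-- The degree hypothesis of `isotypicSum_kroneckerPow_unitTensor_ne_zero_of_indecomposables` is a THEOREM for `t = ⟨n,n,n⟩` at every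
format `m ≥ n²`: a triple occurring for `⟨n,n,n⟩` in degree `d ≤ m` occurs for `⟨m⟩` (padding is invisible; degree engine).
[cite: BurgisserIkenmeyer2011, Prop. 3.3] [cite: LandsbergGCT2017, Prop. 8.3.4.1] -/
theorem isotypicSum_kroneckerPow_unitTensor_ne_zero_of_matMul_of_degree_le {n : ℕ} (h : n * n ≤ m) {d : ℕ} (hd : d ≤ m)
    (lam : Fin 3 → Nat.Partition d)
    (hocc : isotypicSum₁ (lam 0) (isotypicSum₂ (lam 1) (isotypicSum₃ (lam 2) (kroneckerPow (matMulTensor ℂ n n n) d))) ≠ 0) :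
    isotypicSum₁ (lam 0) (isotypicSum₂ (lam 1) (isotypicSum₃ (lam 2) (kroneckerPow (unitTensor ℂ m) d))) ≠ 0 := by
  have hocc' := (isotypicSum_kroneckerPow_padTensor_ne_zero_iff (padIdx_injective' n m h)
    (matMulTensor ℂ n n n) lam).2 hocc
  exact isotypicSum_kroneckerPow_unitTensor_ne_zero_of_degree_le hd (padMM ℂ n m h) lam hocc'

/-- **THE LOCALISATION OF THE CRUX (iff).**  `NoOccurrenceObstruction` holds iff for every `τ > 2`, eventually in `n`, at every format
`m ≥ n², n^τ`: every triple occurring for `⟨n,n,n⟩` in degree `d > m` EITHER occurs for `⟨m⟩` OR is a row-wise sum of two triples of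
positive degree occurring for `⟨n,n,n⟩`.  Equivalently: the obligations of `P_O` are exactly the row-wise INDECOMPOSABLE elements of the
semigroup `S(⟨n,n,n⟩)` of degree `> m` — finitely many per `n`, among them (by the HONEST RANGE note in the header) elements of degree
`≥ n³` if cubes occur for `⟨n,n,n⟩`.  (`⟹`: take the first disjunct; `⟸`: §3's induction with the degree engine as base.)
[cite: BurgisserIkenmeyer2011, Def. 3.1, §3.2, §10.4] -/
theorem noOccurrenceObstruction_iff_indecomposables : NoOccurrenceObstruction ↔
    ∀ τ : ℝ, 2 < τ → ∃ n₀ : ℕ, ∀ n m : ℕ, n₀ ≤ n → n * n ≤ m → (n : ℝ) ^ τ ≤ (m : ℝ) →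
      ∀ d : ℕ, m < d → ∀ lam : Fin 3 → Nat.Partition d,
      isotypicSum₁ (lam 0) (isotypicSum₂ (lam 1) (isotypicSum₃ (lam 2) (kroneckerPow (matMulTensor ℂ n n n) d))) ≠ 0 →
      isotypicSum₁ (lam 0) (isotypicSum₂ (lam 1) (isotypicSum₃ (lam 2) (kroneckerPow (unitTensor ℂ m) d))) ≠ 0 ∨
      ∃ (d₁ d₂ : ℕ) (mu : Fin 3 → Nat.Partition d₁) (nu : Fin 3 → Nat.Partition d₂), 0 < d₁ ∧ 0 < d₂ ∧ d₁ + d₂ = d ∧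
        isotypicSum₁ (mu 0) (isotypicSum₂ (mu 1) (isotypicSum₃ (mu 2) (kroneckerPow (matMulTensor ℂ n n n) d₁))) ≠ 0 ∧
        isotypicSum₁ (nu 0) (isotypicSum₂ (nu 1) (isotypicSum₃ (nu 2) (kroneckerPow (matMulTensor ℂ n n n) d₂))) ≠ 0 ∧
        ∀ s, Weight.ofPartition m (lam s) = Weight.ofPartition m (mu s) + Weight.ofPartition m (nu s) := by
  rw [noOccurrenceObstruction_iff_semigroup_containment]
  refine ⟨fun hP τ hτ => ?_, fun hI τ hτ => ?_⟩
  · obtain ⟨n₀, hn₀⟩ := hP τ hτ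
    exact ⟨n₀, fun n m hn hnm hτm d _ lam hocc => Or.inl (hn₀ n m hn hnm hτm d lam hocc)⟩
  · obtain ⟨n₀, hn₀⟩ := hI τ hτ
    refine ⟨n₀, fun n m hn hnm hτm d lam hocc => ?_⟩
    exact isotypicSum_kroneckerPow_unitTensor_ne_zero_of_indecomposables (matMulTensor ℂ n n n)
      (fun d hd lam hocc => isotypicSum_kroneckerPow_unitTensor_ne_zero_of_matMul_of_degree_le hnm hd lam hocc)
      (hn₀ n m hn hnm hτm) lam hocc

/-- `P_O` ⟸ splitting at `(n², m)` for all `m ≥ n², n^τ`, every `τ > 2` (composition of §2 with `noOccurrenceObstruction_of_unitSaturation`).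
**RECORD ONLY — NOT A USABLE SUFFICIENT CONDITION:** by the header's HONEST RANGE note the hypothesis FAILS at every `m < D(n²)`, and
`D(n²) ≥ n²·e'(n²) ≥ n³` (cube indecomposables, Bürgisser–Ikenmeyer 2017 Ex. 5.6), so as quantified (all `τ > 2`) it is unsatisfiable;
use `noOccurrenceObstruction_iff_indecomposables`. [cite: BurgisserIkenmeyer2011, §3.2, §10.4] [cite: BurgisserIkenmeyer2017, Ex. 5.6] -/
theorem noOccurrenceObstruction_of_splitting
    (h : ∀ τ : ℝ, 2 < τ → ∃ n₀ : ℕ, ∀ n m : ℕ, n₀ ≤ n → n * n ≤ m → (n : ℝ) ^ τ ≤ (m : ℝ) →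
      ∀ d : ℕ, m < d → ∀ lam : Fin 3 → Nat.Partition d, (∀ s, (lam s).parts.card ≤ n * n) →
      (∃ t : Tensor ℂ m, isotypicSum₁ (lam 0) (isotypicSum₂ (lam 1) (isotypicSum₃ (lam 2) (kroneckerPow t d))) ≠ 0) →
      ∃ (d₁ d₂ : ℕ) (mu : Fin 3 → Nat.Partition d₁) (nu : Fin 3 → Nat.Partition d₂),
        0 < d₁ ∧ 0 < d₂ ∧ d₁ + d₂ = d ∧ (∀ s, (mu s).parts.card ≤ n * n) ∧ (∀ s, (nu s).parts.card ≤ n * n) ∧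
        (∃ t : Tensor ℂ m, isotypicSum₁ (mu 0) (isotypicSum₂ (mu 1) (isotypicSum₃ (mu 2) (kroneckerPow t d₁))) ≠ 0) ∧
        (∃ t : Tensor ℂ m, isotypicSum₁ (nu 0) (isotypicSum₂ (nu 1) (isotypicSum₃ (nu 2) (kroneckerPow t d₂))) ≠ 0) ∧
        ∀ s, Weight.ofPartition m (lam s) = Weight.ofPartition m (mu s) + Weight.ofPartition m (nu s)) :
    NoOccurrenceObstruction := by
  refine noOccurrenceObstruction_of_unitSaturation fun τ hτ => ?_
  obtain ⟨n₀, hn₀⟩ := h τ hτ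
  exact ⟨n₀, fun n m hn hnm hτm Λ d hsupp hU => hwvSpace_eq_bot_of_splitting (hn₀ n m hn hnm hτm) Λ d hsupp hU⟩

end Summit.MatrixMultiplication.MatrixMultiplication.Theorems.ObstructionCalculus

end
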